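import Summits.RiemannHypothesis.RiemannHypothesis.Theses.SpectralTrace
import Summits.RiemannHypothesis.RiemannHypothesis.Theorems.WindowStep.Negative.Collapse
import Summits.RiemannHypothesis.RiemannHypothesis.Theorems.SpectralTraceWindowCompactness
import Literature.NumberTheory.LFunctions.WeilArchimedeanPositivityHolds
import Literature.NumberTheory.LFunctions.UniformWeilPositivityRH
import HarnessLib

/-!
# StrategySketch2 — strategist s1 (gen 1, cone change 2026-08-17), companion to
`Cruxes/SpectralThesis/STRATEGY-CENSUS.md` §10

Kernel-checked versions of the §10 census entries for the crux `SpectralThesis` (X,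
stmt-RiemannHypothesis-0187) after the cone change that split the seed
`WindowTraceArch ⟸ UndressingPrinciple ∧ DressedZeros` (items stmt-17980 / stmt-17979 / stmt-17988)
and cut the step (`WindowStep ⟸ CrystRegular ∧ NoDegenerateEdge`, line split-birth).

* §10 D7 `spectralThesis_of_undressing` : `UndressingPrinciple → DressedZeros → WindowStep → X`
  (the finest typed split of X through the new seed), with its residual made explicit:
  `windowStep_iff_riemannHypothesis_of_undressing`, `windowStep_iff_spectralThesis_of_undressing` —
  under the two new seed pieces the step IS X (and RH); the split moves no X-level content.
* §10 S7 `UniversalUndressing` : the X-level (all-window) undressing principle;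
  `universalUndressing_at_weilFunctional` : at `S = W` it is a THEOREM of the tree (content-free),
  and `spectralThesis_of_universalUndressing` shows its residual is full Weil positivity (≡ RH,
  `weil_criterion_holds`).
* §10 S8 `UndressingOn A` : the window-A undressing principle; `windowTrace_iff_weilPositivityOn`
  shows `(∀ A, UndressingOn A) ∧ DressedZeros` only identifies the trace ladder with the Weil
  positivity ladder, whose limit is RH (`riemannHypothesis_iff_forall_weilPositivityOn`), so at X
  nothing is gained over the positivity routes.

Every theorem here is glue over landed theorems; 0 sorries. Nothing here is a line or a stub.
-/

open Complex Set

namespace Summit.RiemannHypothesis.RiemannHypothesis.Cruxes.SpectralThesis.StrategySketch2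

open Literature.NumberTheory.LFunctions
open Summit.RiemannHypothesis.RiemannHypothesis.Theses.SpectralTrace
open Summit.RiemannHypothesis.RiemannHypothesis.Theorems
open Summit.RiemannHypothesis.RiemannHypothesis.Theorems.WindowStep.Negative

/-! ## §10 D7 — the new seed split composed with the step -/

/-- The glue of item stmt-17988 (`WindowTraceArchOfUndressing`), re-proved here so that this file
does not depend on a Theorems/ transplant: instantiate the undressing principle at `S := W` with the
dressed zeros; positivity on the half window is Yoshida's theorem (PROVED in tree). [folklore] -/
theorem windowTraceArch_of_undressing (h₁ : UndressingPrinciple) (h₂ : DressedZeros) :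
    WindowTraceArch := by
  obtain ⟨ι₀, γ, b, hb, hfar, hconj, hrefl, hcount, hsum⟩ := h₂
  exact h₁ ι₀ γ b weilFunctional hb hfar hconj hrefl hcount hsum
    (fun h hh hs => weilPositivityOn_log_two_half_holds h hh hs)

/-- §10 D7: the finest in-tree typed split of X through the new cone,
`X ⟸ UndressingPrinciple ∧ DressedZeros ∧ WindowStep`. [folklore] -/
theorem spectralThesis_of_undressing (h₁ : UndressingPrinciple) (h₂ : DressedZeros)
    (h₃ : WindowStep) : SpectralThesis :=
  (windowStep_iff_windowTraceArch_imp_spectralThesis.mp h₃) (windowTraceArch_of_undressing h₁ h₂)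

/-- §10 D7 residual: granted the two new seed pieces, the step is logically THE SUMMIT.
[folklore] -/
theorem windowStep_iff_riemannHypothesis_of_undressing (h₁ : UndressingPrinciple)
    (h₂ : DressedZeros) : WindowStep ↔ _root_.RiemannHypothesis := by
  rw [windowStep_iff_windowTraceArch_imp_riemannHypothesis]
  exact ⟨fun h => h (windowTraceArch_of_undressing h₁ h₂), fun h _ => h⟩

/-- §10 D7 residual, X-spelling: granted the two new seed pieces, the step is X itself, so the
split `X ⟸ UP ∧ DZ ∧ Step` carries no X-level content beyond its pieces. [folklore] -/
theorem windowStep_iff_spectralThesis_of_undressing (h₁ : UndressingPrinciple)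
    (h₂ : DressedZeros) : WindowStep ↔ SpectralThesis := by
  rw [windowStep_iff_windowTraceArch_imp_spectralThesis]
  exact ⟨fun h => h (windowTraceArch_of_undressing h₁ h₂), fun h _ => h⟩

/-! ## §10 S7 — the X-level (all-window) undressing principle is content-free -/

/-- S7: "universal undressing on ALL windows": a dressed real configuration (same hypotheses as
`UndressingPrinciple`) whose functional `S` is Weil-positive on EVERY autocorrelation is reproduced
on every Weil test by an honest real family. [this route, strategist census §10 S7] -/
def UniversalUndressing : Prop :=
  ∀ (ι₀ : Type) (γ b : ι₀ → ℝ) (S : (ℝ → ℂ) → ℂ), (∀ i, |b i| < 1 / 2) →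
    (∀ i, |γ i| ≤ 100 → b i = 0) →
    (∃ e : ι₀ ≃ ι₀, ∀ i, γ (e i) = -γ i ∧ b (e i) = b i) →
    (∃ e : ι₀ ≃ ι₀, ∀ i, γ (e i) = γ i ∧ b (e i) = -b i) →
    (∃ C T₀ : ℝ, ∀ T : ℝ, T₀ ≤ T → {i : ι₀ | |γ i| ≤ T}.Finite ∧
      |(({i : ι₀ | |γ i| ≤ T}.ncard : ℕ) : ℝ) -
        2 * (T / (2 * Real.pi) * Real.log (T / (2 * Real.pi)) - T / (2 * Real.pi))| ≤
          C * Real.log T) →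
    (∀ g : ℝ → ℂ, IsWeilTest g →
      HasSum (fun i => weilMellin g (1 / 2 + (b i : ℂ) + (γ i : ℂ) * I)) (S g)) →
    (∀ h : ℝ → ℂ, IsWeilTest h → 0 ≤ (S (weilConv h (weilReflect h))).re) →
    ∃ (ι : Type) (γ' : ι → ℝ), ∀ g : ℝ → ℂ, IsWeilTest g →
      HasSum (fun j => weilMellin g (1 / 2 + (γ' j : ℂ) * I)) (S g)

/-- S7 (i): the residual of the X-level undressing principle is FULL Weil positivity: from
`UniversalUndressing`, the dressed zeros and `∀ h, 0 ≤ Re W(h ⋆ h̃)` one gets X. [folklore] -/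
theorem spectralThesis_of_universalUndressing (h₁ : UniversalUndressing) (h₂ : DressedZeros)
    (hpos : ∀ h : ℝ → ℂ, IsWeilTest h → 0 ≤ (weilQuadratic h).re) : SpectralThesis := by
  obtain ⟨ι₀, γ, b, hb, hfar, hconj, hrefl, hcount, hsum⟩ := h₂
  exact h₁ ι₀ γ b weilFunctional hb hfar hconj hrefl hcount hsum hpos

/-- S7 (ii): … and that residual is the summit: full Weil positivity ↔ RH (Weil's criterion, in
tree). [Bombieri2000Weil, Thm 1] -/
theorem weilPositivity_all_iff_riemannHypothesis :
    (∀ h : ℝ → ℂ, IsWeilTest h → 0 ≤ (weilQuadratic h).re) ↔ _root_.RiemannHypothesis := by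
  rw [riemannHypothesis_iff_forall_weilPositivityOn]
  constructor
  · intro h a _ g hg _
    exact h g hg
  · intro h g hg
    obtain ⟨r, hr⟩ := (hg.2 : HasCompactSupport g).isCompact.isBounded.subset_closedBall 0
    have ha : 0 < max r 1 := lt_of_lt_of_le one_pos (le_max_right r 1)
    refine h (max r 1) ha g hg ?_
    intro x hx
    have hx' := hr hx
    rw [Metric.mem_closedBall, dist_zero_right, Real.norm_eq_abs] at hx'
    have hxa : |x| ≤ max r 1 := hx'.trans (le_max_left r 1)
    exact ⟨by linarith [neg_abs_le x], (le_abs_self x).trans hxa⟩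

/-- S7 (iii): at `S = W` (the only instance the route uses) the X-level undressing principle is a
THEOREM of the tree — positivity on all autocorrelations gives RH (Weil), RH gives X
(`spectralThesis_of_riemannHypothesis`): the dressing hypotheses are never used. So lifting the
window principle to X removes exactly the slack (fixed window, free far field) that made it a
crux. [folklore] -/
theorem universalUndressing_at_weilFunctional (ι₀ : Type) (γ b : ι₀ → ℝ)
    (_hsum : ∀ g : ℝ → ℂ, IsWeilTest g →
      HasSum (fun i => weilMellin g (1 / 2 + (b i : ℂ) + (γ i : ℂ) * I)) (weilFunctional g))
    (hpos : ∀ h : ℝ → ℂ, IsWeilTest h → 0 ≤ (weilFunctional (weilConv h (weilReflect h))).re) :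
    ∃ (ι : Type) (γ' : ι → ℝ), ∀ g : ℝ → ℂ, IsWeilTest g →
      HasSum (fun j => weilMellin g (1 / 2 + (γ' j : ℂ) * I)) (weilFunctional g) :=
  spectralThesis_of_riemannHypothesis (weilPositivity_all_iff_riemannHypothesis.mp hpos)

/-! ## §10 S8 — `∀ A, UndressingOn A` only renames the trace ladder as the positivity ladder -/

/-- S8: the undressing principle on the window `[-A, A]` (positivity asked on the half window
`[-A/2, A/2]`); `UndressingOn (Real.log 2)` is the route's `UndressingPrinciple` up to the
spelling `-(log 2 / 2)` vs `-(log 2) / 2`. [this route, strategist census §10 S8] -/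
def UndressingOn (A : ℝ) : Prop :=
  ∀ (ι₀ : Type) (γ b : ι₀ → ℝ) (S : (ℝ → ℂ) → ℂ), (∀ i, |b i| < 1 / 2) →
    (∀ i, |γ i| ≤ 100 → b i = 0) →
    (∃ e : ι₀ ≃ ι₀, ∀ i, γ (e i) = -γ i ∧ b (e i) = b i) →
    (∃ e : ι₀ ≃ ι₀, ∀ i, γ (e i) = γ i ∧ b (e i) = -b i) →
    (∃ C T₀ : ℝ, ∀ T : ℝ, T₀ ≤ T → {i : ι₀ | |γ i| ≤ T}.Finite ∧
      |(({i : ι₀ | |γ i| ≤ T}.ncard : ℕ) : ℝ) -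
        2 * (T / (2 * Real.pi) * Real.log (T / (2 * Real.pi)) - T / (2 * Real.pi))| ≤
          C * Real.log T) →
    (∀ g : ℝ → ℂ, IsWeilTest g →
      HasSum (fun i => weilMellin g (1 / 2 + (b i : ℂ) + (γ i : ℂ) * I)) (S g)) →
    (∀ h : ℝ → ℂ, IsWeilTest h → tsupport h ⊆ Icc (-(A / 2)) (A / 2) →
      0 ≤ (S (weilConv h (weilReflect h))).re) →
    ∃ (ι : Type) (γ' : ι → ℝ), ∀ g : ℝ → ℂ, IsWeilTest g → tsupport g ⊆ Icc (-A) A →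
      HasSum (fun j => weilMellin g (1 / 2 + (γ' j : ℂ) * I)) (S g)

/-- S8: granted `UndressingOn A` and the dressed zeros, the rung `Trace(A)` is EQUIVALENT to Weil
positivity on the half window — (←) is the undressing principle at `S = W`, (→) is the landed
`weilPositivityOn_of_windowTrace`. So `∀ A, UndressingOn A` identifies the trace ladder with the
positivity ladder `∀ a, WeilPositivityOn a`, i.e. with RH
(`riemannHypothesis_iff_forall_weilPositivityOn`); at the level of X no slack is created. [folklore] -/
theorem windowTrace_iff_weilPositivityOn {A : ℝ} (h₁ : UndressingOn A) (h₂ : DressedZeros) :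
    (∃ (ι : Type) (γ : ι → ℝ), ∀ g : ℝ → ℂ, IsWeilTest g → tsupport g ⊆ Icc (-A) A →
      HasSum (fun i => weilMellin g (1 / 2 + (γ i : ℂ) * I)) (weilFunctional g)) ↔
    WeilPositivityOn (A / 2) := by
  constructor
  · rintro ⟨ι, γ, hγ⟩
    have hγ' : ∀ g : ℝ → ℂ, IsWeilTest g → tsupport g ⊆ Icc (-(2 * (A / 2))) (2 * (A / 2)) →
        HasSum (fun i => weilMellin g (1 / 2 + (γ i : ℂ) * I)) (weilFunctional g) := by
      intro g hg hgs
      exact hγ g hg (by rwa [show 2 * (A / 2) = A by ring] at hgs)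
    exact weilPositivityOn_of_windowTrace hγ'
  · intro hpos
    obtain ⟨ι₀, γ, b, hb, hfar, hconj, hrefl, hcount, hsum⟩ := h₂
    exact h₁ ι₀ γ b weilFunctional hb hfar hconj hrefl hcount hsum (fun h hh hs => hpos h hh hs)

/-- S8, limit form: granted every `UndressingOn A` and the dressed zeros, X ↔ the positivity
ladder — which is RH by Weil–Yoshida, already in tree WITHOUT any hypothesis
(`spectralThesis_iff_riemannHypothesis`, Disproof.lean). [folklore] -/
theorem spectralThesis_iff_forall_weilPositivityOn_of_undressingOn (h₁ : ∀ A, UndressingOn A)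
    (h₂ : DressedZeros) : SpectralThesis ↔ ∀ a : ℝ, 0 < a → WeilPositivityOn a := by
  constructor
  · rintro ⟨ι, γ, hγ⟩ a _
    exact (windowTrace_iff_weilPositivityOn (h₁ (2 * a)) h₂).mp
      ⟨ι, γ, fun g hg _ => hγ g hg⟩ |> fun h => by rwa [show 2 * a / 2 = a by ring] at h
  · intro h
    refine windowCompactness_proof fun A hA => ?_
    exact (windowTrace_iff_weilPositivityOn (h₁ A) h₂).mpr (h (A / 2) (by positivity))

end Summit.RiemannHypothesis.RiemannHypothesis.Cruxes.SpectralThesis.StrategySketch2
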